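import Summits.Langlands.Langlands.Theses.ZeroDefectWeightNormalForm

/-!
# Route ZeroDefectWeightNormalForm — Assembly

The assembly item (stmt-Langlands-27707) of the child route `ZeroDefectWeightNormalForm` (decomp-langlands lens-4 gen 22; `--refines route-Langlands-MinimalLevelDescent:LevelOneCrystallineDescent`, edge split, depth 1) for
Z = `MinimalLevelDescent.LevelOneCrystallineDescent` (stmt-Langlands-31277):
`BoundedWeightRepresentative → BoundedWeightLevelOneDescent → PositiveDefectLevelOneDescent → MinimalLevelDescent.LevelOneCrystallineDescent`.

This is literally the type of the route file's sorry-free deciding theorem `Summit.Langlands.Langlands.Theses.ZeroDefectWeightNormalForm.closes`.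
Nothing here proves `Langlands` (nor the parent piece): the assembly records only that the three cell items of the route (RED, ZB, ZP), taken together,
imply the parent piece by name.
-/

set_option linter.dupNamespace false -- project-wide option (lakefile weak.linter.dupNamespace); `Summit.Langlands.Langlands` is the mandated namespace

namespace Summit.Langlands.Langlands.Theorems

/-- **Assembly of route ZeroDefectWeightNormalForm** (stmt-Langlands-27707): `BoundedWeightRepresentative → BoundedWeightLevelOneDescent → PositiveDefectLevelOneDescent → MinimalLevelDescent.LevelOneCrystallineDescent`.
Proof: unfold `Assembly` and apply the route's deciding theorem `Theses.ZeroDefectWeightNormalForm.closes`. -/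
theorem zeroDefectWeightNormalForm_assembly_proof :
    Summit.Langlands.Langlands.Theses.ZeroDefectWeightNormalForm.Assembly := by
  unfold Summit.Langlands.Langlands.Theses.ZeroDefectWeightNormalForm.Assembly
  exact Summit.Langlands.Langlands.Theses.ZeroDefectWeightNormalForm.closes

end Summit.Langlands.Langlands.Theorems
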